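import Literature.NumberTheory.EllipticCurves.MordellWeilTheoremProofs
import Summits.BirchSwinnertonDyer.Rank1Residual.F1Sign2.KummerEntanglementAtTwo
import HarnessLib

/-!
# Line `fkl` of crux `RankOneAtTwoBigImageOddLocal` (stmt-BirchSwinnertonDyer-23715, route ByReductionTypeAtTwo):
# the Mordell–Weil support 2SAT of K2-F is a THEOREM, and the reductions of the hardest stub it unlocks

Lead prover seat `bsd-line-fkl-p1` (g0), helpers `--supports stmt-BirchSwinnertonDyer-23715` (registered stub
`stub_katoFirstLayerLaw : F1Sign2.FirstLayerLawAtTwo`, the HARDEST stub of line `fkl`).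

1. `exists_point_not_two_divisible_of_rank_one`: over any number field, Mordell–Weil rank one ⇒ there is a
   non-torsion point not divisible by `2` (a generator of `E(K)/tors ≅ ℤ`; from the tree's PROVED Mordell–Weil theorem
   `WeierstrassCurve.exists_isMordellWeilBasis_holds`, standard axioms).
2. `twoSaturatedPointAtTwo_holds`: the support `F1Sign2.TwoSaturatedPointAtTwo` of `F1Sign2/SquareLawAtTwo.lean`
   («THEOREM, trivial given a Mordell–Weil basis» — now kernel-checked; its odd-torsion binder is not used).
3. Consequences for the hardest stub (pure glue over the tree's `firstLayerLawAtTwo_of_squareLaw`,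
   `analyticFirstLayerLawAtTwo_of_squareLaw`, `kummerPrimeAtTwo_of_dichotomy`, `entangledKummerPrimeLaw_of_traceLaw`):
   K2-F ⟸ K2-F♯ ∧ KUM; K2-F ⟸ K2-F♯ ∧ KENT ∧ CHEB1 ∧ CHEB2; K2-F ⟸ K2-F♯ ∧ KENT′ ∧ CHEB1 ∧ CHEB2; and the analytic twins
   (K2-F_an ⟸ K2-F♯_an ∧ KUM ∧ GZK, …).  After this file the open content of `stub_katoFirstLayerLaw` along the square-law
   road is exactly {`SquareLawAtTwo` (conjecture, beyond print), `KummerPrimeAtTwo` (in-print assembly: Kummer theory +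
   Chebotarev, or KENT/KENT′ (finite group cohomology of `GL₂(ℤ/4)`, theorem-grade per REF1 §50) + CHEB1/CHEB2)}.
Nothing is asserted: theorems only, no `def`, no named fact, no `sorry`.  BSD is not proved by any of this.
-/

noncomputable section

open scoped Classical

set_option linter.dupNamespace false

namespace Summit.BirchSwinnertonDyer.BirchSwinnertonDyer.Theorems.RankOneAtTwoFkl

open WeierstrassCurve Literature.NumberTheory.EllipticCurves Summit.BirchSwinnertonDyer.Rank1Residual.F1Sign2

/-- **Rank one ⇒ a `2`-saturated non-torsion point.** For an elliptic curve over a number field with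
`rank_ℤ E(K) = 1` there is `P ∈ E(K)` of infinite order with `P ∉ 2E(K)`: the single element of a Mordell–Weil basis
(`exists_isMordellWeilBasis_holds`, the tree's proved Mordell–Weil theorem) — its class generates `E(K)/tors ≅ ℤ`, so
`n • P` torsion forces `n = 0` and `2 • Q = P` would make `1` even.  The `DecidableEq K` instance behind the group law
is arbitrary (first line: all such instances are equal). [folklore] -/
theorem exists_point_not_two_divisible_of_rank_one {K : Type*} [Field K] [NumberField K]
    [inst : DecidableEq K] (W : WeierstrassCurve K) [W.IsElliptic] (hr : W.mordellWeilRank = 1) :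
    ∃ P : W.toAffine.Point, (∀ n : ℕ, n ≠ 0 → n • P ≠ 0) ∧ ∀ Q : W.toAffine.Point, 2 • Q ≠ P := by
  obtain rfl : inst = fun a b => Classical.propDecidable (a = b) := Subsingleton.elim _ _
  obtain ⟨P, hli, hsp⟩ := W.exists_isMordellWeilBasis_holds
  let i₀ : Fin W.mordellWeilRank := ⟨0, by omega⟩
  have hi : ∀ i : Fin W.mordellWeilRank, i = i₀ :=
    fun i => Fin.ext (by have := i.2; simp [i₀]; omega)
  have hv0 := hli.ne_zero i₀
  simp only [Function.comp_apply] at hv0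
  have hzs : ∀ c : ℤ, c • (QuotientAddGroup.mk (P i₀) : mordellWeilModTorsion W) = 0 → c = 0 :=
    fun c hc => (smul_eq_zero.mp hc).resolve_right hv0
  refine ⟨P i₀, ?_, ?_⟩
  · intro n hn hnP
    have h1 : (n : ℤ) • (QuotientAddGroup.mk (P i₀) : mordellWeilModTorsion W) = 0 := by
      rw [natCast_zsmul, ← QuotientAddGroup.mk_nsmul, hnP, QuotientAddGroup.mk_zero]
    exact hn (by exact_mod_cast hzs n h1)
  · intro Q hQ
    have hmem : (QuotientAddGroup.mk Q : mordellWeilModTorsion W) ∈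
        Submodule.span ℤ (Set.range (QuotientAddGroup.mk ∘ P :
          Fin W.mordellWeilRank → mordellWeilModTorsion W)) := by
      rw [hsp]; exact Submodule.mem_top
    have hrange : Set.range (QuotientAddGroup.mk ∘ P : Fin W.mordellWeilRank → mordellWeilModTorsion W) =
        {(QuotientAddGroup.mk (P i₀) : mordellWeilModTorsion W)} := by
      ext x
      simp only [Set.mem_range, Set.mem_singleton_iff, Function.comp_apply]
      constructor
      · rintro ⟨i, rfl⟩; rw [hi i]
      · rintro rfl; exact ⟨i₀, rfl⟩
    rw [hrange, Submodule.mem_span_singleton] at hmem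
    obtain ⟨m, hm⟩ := hmem
    have hvq : (QuotientAddGroup.mk (P i₀) : mordellWeilModTorsion W) =
        (2 : ℤ) • (QuotientAddGroup.mk Q : mordellWeilModTorsion W) := by
      rw [← hQ, QuotientAddGroup.mk_nsmul]
      norm_cast
    have h2 : (2 * m - 1) • (QuotientAddGroup.mk (P i₀) : mordellWeilModTorsion W) = 0 := by
      rw [sub_smul, one_smul, mul_smul, hm, ← hvq, sub_self]
    have := hzs _ h2
    omega

/-- **2SAT is a theorem**: `F1Sign2.TwoSaturatedPointAtTwo` — a rank-one curve over `ℚ` has a non-torsion rational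
point not divisible by `2` in `E(ℚ)` (the odd-torsion binder of the support is not needed). From
`exists_point_not_two_divisible_of_rank_one` (`(W.toAffine.baseChange ℚ).Point` is `W.toAffine.Point` by `rfl`). [folklore] -/
theorem twoSaturatedPointAtTwo_holds : TwoSaturatedPointAtTwo := by
  intro W _ hr _hT
  exact exists_point_not_two_divisible_of_rank_one W hr

/-- **K2-F ⟸ K2-F♯ ∧ KUM** (the tree's `firstLayerLawAtTwo_of_squareLaw` with its Mordell–Weil input discharged):
the square law and the existence of Kummer `τ`-primes give the first-layer law `FirstLayerLawAtTwo`
(= registered stub `stub_katoFirstLayerLaw` of line fkl). [conjecture] inputs, kernel glue. -/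
theorem firstLayerLawAtTwo_of_squareLaw_of_kummerPrime (hS : SquareLawAtTwo) (hK : KummerPrimeAtTwo) :
    FirstLayerLawAtTwo :=
  firstLayerLawAtTwo_of_squareLaw hS hK twoSaturatedPointAtTwo_holds

/-- **K2-F_an ⟸ K2-F♯_an ∧ KUM ∧ GZK** (the tree's `analyticFirstLayerLawAtTwo_of_squareLaw` with 2SAT discharged).
[conjecture] inputs, kernel glue. -/
theorem analyticFirstLayerLawAtTwo_of_squareLaw_of_kummerPrime (hS : AnalyticSquareLawAtTwo)
    (hK : KummerPrimeAtTwo) (hGZK : rank_eq_analyticRank_of_analyticRank_le_one) :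
    AnalyticFirstLayerLawAtTwo :=
  analyticFirstLayerLawAtTwo_of_squareLaw hS hK twoSaturatedPointAtTwo_holds hGZK

/-- **K2-F ⟸ K2-F♯ ∧ KENT ∧ CHEB1 ∧ CHEB2**: the square law plus the entanglement dichotomy for Kummer primes
(`kummerPrimeAtTwo_of_dichotomy`: entangled points use any deep `τ`-prime by KENT + CHEB1, disentangled points use
CHEB2 = Jones–Rouse 2010 Thm 5.2 + Chebotarev) give the first-layer law. [conjecture] inputs, kernel glue. -/
theorem firstLayerLawAtTwo_of_squareLaw_of_dichotomy (hS : SquareLawAtTwo) (hE : EntangledKummerPrimeLawAtTwo)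
    (hL : LevelPrimesExistAtTwo) (hD : DisentangledKummerPrimeAtTwo) : FirstLayerLawAtTwo :=
  firstLayerLawAtTwo_of_squareLaw_of_kummerPrime hS (kummerPrimeAtTwo_of_dichotomy hE hL hD)

/-- **K2-F ⟸ K2-F♯ ∧ KENT′ ∧ CHEB1 ∧ CHEB2**: the same with the TRACE LAW KENT′ (`P ∈ 2E(ℚ_ℓ) ⟺ a_ℓ ≡ 0 (mod 4)` at
`τ`-primes for entangled `P`) in place of KENT (`entangledKummerPrimeLaw_of_traceLaw`). [conjecture] inputs, kernel glue. -/
theorem firstLayerLawAtTwo_of_squareLaw_of_traceLaw (hS : SquareLawAtTwo) (hT : EntangledKummerTraceLawAtTwo)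
    (hL : LevelPrimesExistAtTwo) (hD : DisentangledKummerPrimeAtTwo) : FirstLayerLawAtTwo :=
  firstLayerLawAtTwo_of_squareLaw_of_dichotomy hS (entangledKummerPrimeLaw_of_traceLaw hT) hL hD

/-- **K2-F_an ⟸ K2-F♯_an ∧ KENT ∧ CHEB1 ∧ CHEB2 ∧ GZK** (analytic twin of `firstLayerLawAtTwo_of_squareLaw_of_dichotomy`).
[conjecture] inputs, kernel glue. -/
theorem analyticFirstLayerLawAtTwo_of_squareLaw_of_dichotomy (hS : AnalyticSquareLawAtTwo)
    (hE : EntangledKummerPrimeLawAtTwo) (hL : LevelPrimesExistAtTwo) (hD : DisentangledKummerPrimeAtTwo)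
    (hGZK : rank_eq_analyticRank_of_analyticRank_le_one) : AnalyticFirstLayerLawAtTwo :=
  analyticFirstLayerLawAtTwo_of_squareLaw_of_kummerPrime hS (kummerPrimeAtTwo_of_dichotomy hE hL hD) hGZK

/-- **Both laws at once from the square-law package**: K2-F ∧ K2-F_an ⟸ K2-F♯ ∧ K2-F♯_an ∧ KUM ∧ GZK — the input pair of
the tree glue `F1Sign2.bsdp_two_of_firstLayerLaws` (p561832) on the `fkl` skeleton. [conjecture] inputs, kernel glue. -/
theorem firstLayerLaws_of_squareLaws (hS : SquareLawAtTwo) (hSa : AnalyticSquareLawAtTwo) (hK : KummerPrimeAtTwo)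
    (hGZK : rank_eq_analyticRank_of_analyticRank_le_one) : FirstLayerLawAtTwo ∧ AnalyticFirstLayerLawAtTwo :=
  ⟨firstLayerLawAtTwo_of_squareLaw_of_kummerPrime hS hK,
    analyticFirstLayerLawAtTwo_of_squareLaw_of_kummerPrime hSa hK hGZK⟩

end Summit.BirchSwinnertonDyer.BirchSwinnertonDyer.Theorems.RankOneAtTwoFkl

end
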